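import Literature.NumberTheory.Kottwitz1992.HermitianSymmetricSpaces
import Literature.AlgebraicGeometry.AbelianSchemes.PolarizedAbelianSchemeWithLevel     -- ★ `PolarizedAbelianSchemeWithLevel`, `IsBaseChangeVia` (ED. 2)
import Literature.AlgebraicGeometry.AbelianSchemes.AbelianSchemeFixedPowBaseChange       -- ★ `AbelianSchemeOver.RingAction.baseChange` (ED. 2)
import Literature.AlgebraicGeometry.AbelianSchemes.AbelianSchemeDualIsogeny              -- ★ `DualPair.dualIsogenyOver` (ED. 2)
import Literature.AlgebraicGeometry.AbelianSchemes.AbelianSchemeCotangentCharpoly        -- ★ `AbelianScheme.lieCharpoly` (ED. 2)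
import Literature.AlgebraicGeometry.Morphisms.ProjectiveMorphism                        -- ★ `Morphisms.IsProjective` (ED. 2)
import Literature.AlgebraicGeometry.Morphisms.QuasiProjectiveMorphism                   -- ★ `Morphisms.IsQuasiProjective` (ED. 2)
import HarnessLib

/-!
# Kottwitz 1992, §5 «Moduli spaces of PEL type» — statement carpet (the rational PEL datum, Cases A ∕ C ∕ D, the
# determinant criterion of p. 390, `m` even, the shape of `C_ℝ`)

R. E. Kottwitz, *Points on some Shimura varieties over finite fields*, J. Amer. Math. Soc. **5** (1992) 373–444
[Kottwitz1992], §5, pp. 389–392 (held text `paper:doi-10-2307-2152772`, PDF pages p0017–p0020 = printed pages 389–392).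
Carpet-typing squad TK (cell hodgecm-mathlib, seat TK-t02): STATEMENTS ONLY (named facts `def Kottwitz1992_5_… : Prop`, one
interface structure `PELDatumQ`; no proof, no `sorry`, no `axiom`, no `instance`, no notation).  §5 has no numbered items; the
load-bearing sentences are numbered here (5.a)–(5.k) in print order and each is either TYPED below or mapped to the tree
declarations that already carry it (§5 is cited by 125 tree files — DEDUP census at the end of this docstring).

## The print (verbatim extracts, pp. 389–392)

(5.a) DATA (p. 389, p0017 L12–L33): «Let `B` be a finite-dimensional simple `ℚ`-algebra with center `F`, and assume that
`B_{ℚ_p}` is a product of matrix algebras over unramified extensions of `ℚ_p` […]. Let `𝒪_B` be a `ℤ_(p)`-order in `B` whose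
`p`-adic completion is a maximal order in `B_{ℚ_p}`. Let `*` be a positive involution on `B` over `ℚ` (recall that this means
that `*` induces a positive involution on `B_ℝ`) that preserves the order `𝒪_B`. Denote by `F₀` the fixed field of `*` on `F`.
Let `V` be a nonzero finitely generated left `B`-module. Let `⟨·,·⟩` be a nondegenerate `ℚ`-valued alternating form on `V`
such that `⟨bv, w⟩ = ⟨v, b* w⟩` for all `v, w ∈ V` and all `b ∈ B`. Assume that there exists a lattice `Λ₀` in `V_{ℚ_p}`
that is self-dual for `⟨·,·⟩` and is preserved by `𝒪_B`. Let `C` be the `ℚ`-algebra `End_B(V)`; it is a simple `ℚ`-algebra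
with center `F` and has an involution `*` coming from the form `⟨·,·⟩`. Let `G` be the algebraic group over `ℚ` whose points
in any `ℚ`-algebra `R` are given by `{x ∈ C ⊗_ℚ R | x x* ∈ R^×}`, and let `G₁` be the subgroup whose `R`-points are given by
`{x ∈ C ⊗_ℚ R | x x* = 1}`. […] The first is a compact open subgroup `K^p` of `G(𝔸_f^p)` […]. The second is a
`*`-homomorphism `h : ℂ → C_ℝ` […] such that the symmetric real-valued bilinear form `⟨v, h(i)w⟩` on `V_ℝ` is positive
definite.»
(5.b) (p. 389 L35 – p. 390 L3) `V_ℂ = V₁ ⊕ V₂`, the reflex field `E`, `f(X₁, …, X_t) := det(X₁α₁ + ⋯ + X_tα_t; V₁)`,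
«a homogeneous polynomial of degree `dim_ℂ(V₁)` […] In fact [its coefficients] lie in `𝒪_E ⊗_ℤ ℤ_(p)`».
(5.c) THE MODULI PROBLEM (p. 390, p0018 L4–L13): the set-valued contravariant functor on locally noetherian schemes `S` over
`𝒪_E ⊗_ℤ ℤ_(p)`, `S ↦` isomorphism classes of quadruples `(A, λ, i, η̄)`: `A → S` a projective abelian scheme up to
prime-to-`p` isogeny, `λ : A → Â` a polarization (prime-to-`p`), `i : 𝒪_B → End(A)` a `*`-homomorphism for the Rosati
involution of `λ`, `η̄` a level structure of type `K^p`; isomorphisms of quadruples (p0018 L31–L34); level structures of type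
`K^p` (p0018 L35 – p0019 L12).
(5.d) THE DETERMINANT CONDITION (p. 390, p0018 L14–L21): «the determinant of the `𝒪_S`-linear endomorphism `X₁α₁ + ⋯ + X_tα_t` of
`Lie(A)` is a homogeneous polynomial `g(X₁, …, X_t)` […] we require that `g` be equal to the polynomial `f` […]; this equality
`g = f` is what we mean by the determinant condition.»
(5.e) THE DETERMINANT CRITERION (p. 390, p0018 L22–L30): «Let `E` be a finite-dimensional semisimple algebra over a field `k`,
and let `α₁, …, α_t` be a `k`-basis for `E`. For any finite-dimensional `E`-module `V` define a polynomial `det_V ∈ k[X₁, …, X_t]`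
by `det_V = det(X₁α₁ + ⋯ + X_tα_t; V ⊗_k k[X₁, …, X_t])`. Then `V` is isomorphic to `W` if and only if `det_V = det_W`.»
(5.f) REPRESENTABILITY (p. 391, p0019 L13–L22): «For sufficiently small `K^p` this moduli problem is representable by a
quasiprojective scheme `S_{K^p}` over `𝒪_E ⊗_ℤ ℤ_(p)`. […] it is enough to show that our moduli problem is relatively
representable over his [Mumford's]. […] the key point being the following consequence of Grothendieck's theory of Hilbert
schemes: For any projective abelian scheme `A` over a locally noetherian scheme `S` the functor `T ↦ End(A_T)` on the category of
locally noetherian `S`-schemes `T` is representable by a disjoint union of projective schemes over `S`.»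
(5.g) CASES A, C, D (p. 391, p0019 L23–L41): «The involution `*` is positive on the center `F` of the simple `ℚ`-algebra `B`.
Therefore the fixed field `F₀` of `*` on `F` is totally real, and either `F = F₀`, in which case `*` is said to be of the first
kind, or else `F` is a totally complex quadratic extension of `F₀`, in which case `*` is said to be of the second kind. […]
`G₀(F₀) = G₁(ℚ) = {x ∈ C | x x* = 1}`. Let `m` be the positive integer defined by `[F : F₀](dim_F C)^{1/2}`. The existence of
`h : ℂ → C_ℝ` forces `m` to be even, say `m = 2n`. If `*` is of the second kind, then `G₀` is an inner form of the quasi-split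
unitary group over `F₀` obtained from the quadratic extension `F`; we refer to this as Case A […]. If `*` is of the first kind,
then over an algebraic closure of `F₀`, the group `G₀` is either an orthogonal group in `2n` variables (a group of type `D_n`) or
a symplectic group in `2n` variables (a group of type `C_n`); of course we refer to these as Cases D and C respectively.»
(5.h) THE SHAPE OF `C_ℝ` (p. 391, p0019 L41–L45): «Using that `*` is a positive involution and that our form `⟨·,·⟩` is
skew-Hermitian, one sees easily that in Case C the algebra `C_ℝ` is a product of `[F₀ : ℚ]` copies of `M_{2n}(ℝ)`, and that in
Case D it is a product of `[F₀ : ℚ]` copies of `M_n(ℍ)`; of course in Case A it is a product of `[F₀ : ℚ]` copies of `M_n(ℂ)`.»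
(5.i) SMOOTHNESS (p. 391 L46 – p. 392 L3): «Now assume that `p ≠ 2` if we are in Case D. Then for sufficiently small `K^p` the
scheme `S_{K^p}` is smooth over `𝒪_E ⊗_ℤ ℤ_(p)`.»  (5.j) FINITE TYPE (p. 392, p0020 L4–L9): «`S_{K^p}` is a finite disjoint union
of projective schemes over Mumford's space; in particular `S_{K^p}` is of finite type over `𝒪_E ⊗_ℤ ℤ_(p)`.»  (5.k) PROPERNESS
(p. 392, p0020 L9–L36): «Suppose that `C = End_B(V)` is a division algebra. In this case we will show that `S_{K^p}` is
projective over `𝒪_E ⊗_ℤ ℤ_(p)`, using the valuative criterion of properness.»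

## What is typed here, and how (every deviation is a SPECIALISATION, recorded)

* `PELDatumQ B V` — the RATIONAL AND REAL part of the data (5.a): `B` simple finite-dimensional over `ℚ` with a positive
  involution `* = star` (positivity as the `ℚ`-trace condition `tr_{B/ℚ}(b b*) > 0`, which is equivalent to positivity of the
  induced involution of `B_ℝ`: a rational quadratic form positive on `ℚ^n ∖ 0` is positive definite on `ℝ^n`), the nonzero
  finitely generated left `B`-module `V` (`ρ : B →ₐ[ℚ] End_ℚ(V)`), the nondegenerate alternating skew-Hermitian form, and the
  `*`-homomorphism `h : ℂ → C_ℝ ⊆ End_ℝ(V_ℝ)` (`V_ℝ = ℝ ⊗_ℚ V`, `h` commuting with `B`, adjoint for the base-changed form,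
  `⟨v, h(i)v⟩ > 0`).  `-- TODO(general form):` the `p`-integral data `𝒪_B`, `Λ₀`, the unramifiedness of `B_{ℚ_p}`, and
  `K^p ⊆ G(𝔸_f^p)` are NOT part of the structure (no finite-adele ∕ maximal-order vocabulary is used by the statements below).
* `C = End_B(V)` is `Subalgebra.centralizer ℚ (Set.range ρ)`; `F` = `Subalgebra.center ℚ B`; `F₀` = the `*`-fixed part of
  `F` (as the `ℚ`-submodule `F ⊓ Sym`).  «`C` is a simple `ℚ`-algebra with center `F`» (5.a) is `Kottwitz1992_5_C_simple`.
* Cases (5.g): `IsCaseA` (second kind: `*` non-trivial on `F`); for `*` of the first kind the print splits by the type of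
  `G₀ = {x ∈ C | x x* = 1}` over `F̄₀` (symplectic = Case C, orthogonal = Case D).  Mathlib has no algebraic groups, so the
  split is typed by the classical algebraic proxy on `(B, *)` itself: over `F̄` the first-kind involution `*` of
  `B̄ = M_d(F̄)` is the adjoint of a symmetric (ORTHOGONAL type, `dim_F Sym(B, *) = d(d+1)/2`) or of an alternating
  (SYMPLECTIC type, `dim_F Sym(B, *) = d(d−1)/2`) form `β`; writing `V̄ = F̄^d ⊗ W`, an alternating skew-Hermitian form is
  `β ⊗ γ` with `γ` alternating (resp. symmetric) on `W`, so `G₀ = Sp(W)` — Case C — iff `*` is of orthogonal type on `B`, and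
  `G₀ = O(W)` — Case D — iff `*` is of symplectic type on `B`.  `IsCaseC` ∕ `IsCaseD` are these two conditions, written with
  `d² [F : ℚ] = dim_ℚ B` and `2 dim_ℚ Sym = [F : ℚ] d (d ± 1)`.
* (5.e) `Kottwitz1992_5_det_iff`: `E`-modules as `ρ : E →ₐ[k] End_k(V)`; `det_V` computed in the basis `Module.finBasis k V`
  (it is independent of the basis); any field `k` (the print stresses finite characteristic).
* (5.g) «`m` even» is `Kottwitz1992_5_m_even`, typed for `*` of the first kind (for the second kind `m = 2 (dim_F C)^{1/2}` is
  even by definition) and for an abstract simple `C` whose involution is positive on the centre: an `ℝ`-algebra map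
  `ℂ → C_ℝ` forces `dim_F C = (2n)²`.  (5.h) is `Kottwitz1992_5_CR_caseA ∕ _caseC ∕ _caseD`.
* (5.g) «`F₀` is totally real, and `F = F₀` or `F ∕ F₀` is a totally complex quadratic extension» is ALREADY A TREE THEOREM and
  is cited, not restated: ★ `Literature.NumberTheory.NumberFields.PositiveInvolutionCM.isTotallyReal_or_isCMField_of_trace_mul_nonneg`
  with ★ `…PositiveInvolution.eq_id_iff_isTotallyReal_of_trace_mul_nonneg` (Shimura 1998 §5.1 Lemma 2 ∕ Prop. 5).

## NOT typed here (scheme-level sentences (5.b), (5.c), (5.d), (5.f), (5.i), (5.j), (5.k)) — DEDUP census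

These need `S_{K^p}` as a scheme representing a functor of PEL quadruples.  The cell's programme P6 has built that side as
THEOREMS over its own letters, which a carpet must cite rather than re-declare (TYPER LINT RULE; CONVENTIONS §4):
abelian schemes ★ `Literature.AlgebraicGeometry.AbelianSchemes.AbelianSchemeOver` (`AbelianSchemeOverBase`), the action
`i : 𝒪_B → End(A)` ★ `AbelianSchemeOver.RingAction` (`AbelianSchemeOverRingAction`), polarizations ★ `DualPair` ∕ `Polarization`
(`AbelianSchemeDualPair`, `AbelianSchemePolarization`), level structures ★ `AbelianSchemeOver.LevelStructure`, Mumford's space ★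
`PolarizedAbelianSchemeWithLevel`; the determinant condition (5.d) is read through ★ `AbelianScheme.Lie` (`AbelianSchemePointsLie`,
«(5.2)»), ★ `lieCharpoly` ∕ `cotangentCharpoly` (`AbelianSchemeCotangentCharpoly`) and transported by ★ `KottwitzCharpolyTransport`,
★ `AbelianSchemeLieCharpolyBaseChangeComp`; the «relatively representable over Mumford» step of (5.f) is ★
`AbelianSchemeOver.exists_opens_isClosed_structureTable_rosati_iff` ∕ `exists_ringAction_of_structureTable`
(`EndomorphismStructureLocus`), and Grothendieck's key point of (5.f) is ★ `Literature.AlgebraicGeometry.Morphisms.exists_homScheme_of_projective`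
(`HomSchemeOfProjective`).  (5.i)–(5.k) (Grothendieck–Messing smoothness, finite type, valuative properness) have no tree
carrier and no Mathlib vocabulary (`S_{K^p}`); they are left to the line that needs them.  `G(𝔸_f^p)`, `K^p`, `S_{K^p}` itself:
not in the tree.

## ED. 2 (TK-plan deal v2 (a), 2026-09-02): the moduli problem (5.c)–(5.d) and (5.f), (5.i), (5.j), (5.k) OVER THE CELL'S LETTERS

Appended (§§ «ED. 2» below; nothing above is changed): `IntegralPELDatum` (the `p`-integral data the moduli problem needs
on top of `PELDatumQ`: `p`, the order `𝒪_B → B` with its involution, `n = dim A`, a level `N` prime to `p`, a polarization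
type `δ` prime to `p`, the base ring `R_E` «`𝒪_E ⊗_ℤ ℤ_(p)`» and the Kottwitz polynomials `f_b ∈ R_E[T]`), `KottwitzTuple I S`
(= ★ `PolarizedAbelianSchemeWithLevel n N δ S` + ★ `AbelianSchemeOver.RingAction 𝒪_B A`), the predicate `KottwitzTuple.IsPoint`
((5.c)+(5.d): Rosati compatibility via ★ `DualPair.dualIsogenyOver`, determinant condition via ★ `AbelianScheme.lieCharpoly` at
every local test point), `KottwitzTuple.Iso` (★ `PolarizedAbelianSchemeWithLevel.IsBaseChangeVia` along `𝟙 S` + the action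
clause), `ModuliSchemeData I` (a scheme `S_{K^p} → Spec R_E` with the fine-moduli universal property on locally noetherian
`R_E`-schemes) and the named facts `Kottwitz1992_5_representable` (5.f), `_5_smooth` (5.i), `_5_finiteType` (5.j),
`_5_projective_of_division` (5.k) in the words ★ `Morphisms.IsQuasiProjective` ∕ Mathlib `Smooth`, `LocallyOfFiniteType`,
`QuasiCompact` ∕ ★ `Morphisms.IsProjective`.  GENERALITY GAPS versus the print, each recorded at its declaration:
(g1) ★ `RingAction` takes a COMMUTATIVE coefficient ring, so `𝒪_B` (hence `B`) is commutative here — the print's `B` is any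
simple algebra (`-- TODO(general form)`); (g2) the print's objects are quadruples UP TO PRIME-TO-`p` ISOGENY with `λ` a
`ℤ_(p)^×`-class of polarizations and `η̄` a `π₁(S,s)`-stable `K^p`-orbit of `B`-linear symplectic similitudes
`V ⊗ 𝔸_f^p → H₁(A_s, 𝔸_f^p)`; the letters give honest abelian schemes up to isomorphism with a polarization of type `δ` and
Mumford's full level-`N` structure (the principal level `K^p = K(N)`, `B`-linearity of the level structure NOT imposed);
(g3) the determinant condition is typed in the cell's single-element currency `char(T, ι(b) | Lie A) = f_b(T)` for all
`b ∈ 𝒪_B` (★ `lieCharpoly`, ★ `KottwitzCharpolyTransport`, ★ `KottwitzLocalRingPropagation`) at every local test point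
`Spec R → S`, instead of the one polynomial identity `g(X₁, …, X_t) = f(X₁, …, X_t)`; «sufficiently small `K^p`» is `3 ≤ N`.

ED. 3 (QA-K1, T-ref1 ∕ TK-plan 02:32–02:33Z): the standing hypotheses of p. 389 that (5.f), (5.i), (5.j), (5.k) CONSUME are now
fields of `IntegralPELDatum` — `good_p` (`O ∕ pO` reduced = «unramified at `p`, `𝒪_B ⊗ ℤ_p` maximal» for commutative `O`),
`loc` ∕ `p_nonunit` ∕ `isDomain` ∕ `isIntegrallyClosed` (base `𝒪_E ⊗ ℤ_(p)`), and `f_spec` (the `f_b` ARE the `det(T − b; V₁)`);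
without them `Kottwitz1992_5_smooth` was false as a closed statement (ramified counter-regime: Pappas 2000, PRS 2013 p. 17).

## References

* [Kottwitz1992] §5 pp. 389–392; §2 Definition p. 380 (positive involution); §4 (the data over `ℝ`, ★ `HermitianSymmetricSpaces`).
* [Shimura1998] G. Shimura, *Abelian Varieties with Complex Multiplication and Modular Functions*, §5.1 Lemma 2, Prop. 5 (the
  tree's `PositiveInvolution*.lean`, cited for (5.g)).
-/

open scoped TensorProduct ComplexConjugate Quaternion

namespace Literature.NumberTheory.Kottwitz1992.ModuliProblem

universe u v w

/-! ## (5.a) The rational PEL datum -/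

/-- **The rational and real part of the PEL data of §5** (p. 389, p0017 L12–L33): a finite-dimensional simple `ℚ`-algebra `B`
with positive involution `*` (`tr_{B/ℚ}(b b*) > 0` for `b ≠ 0`), a nonzero finitely generated left `B`-module `V`
(`ρ : B → End_ℚ(V)`), a nondegenerate alternating `ℚ`-bilinear form with `⟨bv, w⟩ = ⟨v, b* w⟩`, and an `ℝ`-algebra map
`h : ℂ → End_ℝ(V_ℝ)` commuting with `B` (so `h : ℂ → C_ℝ`, `C = End_B(V)`) with `⟨h(z)v, w⟩ = ⟨v, h(z̄)w⟩` (a `*`-homomorphism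
for the adjoint involution) and `⟨v, h(i)v⟩ > 0` for `v ≠ 0`.  The `p`-integral data `𝒪_B`, `Λ₀`, the hypothesis on `B_{ℚ_p}`
and the level `K^p` are not recorded (see the module docstring). [cite: Kottwitz1992, §5 (p. 389)] -/
structure PELDatumQ (B : Type u) [Ring B] [Algebra ℚ B] [StarRing B] [StarModule ℚ B]
    (V : Type v) [AddCommGroup V] [Module ℚ V] where
  /-- «`B` a finite-dimensional simple `ℚ`-algebra» -/
  isSimpleRing : IsSimpleRing B
  /-- finite-dimensionality of `B` -/
  finiteDimensional : FiniteDimensional ℚ B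
  /-- «`*` a positive involution on `B`»: `tr_{B/ℚ}(b b*) > 0` for `b ≠ 0` -/
  pos : ∀ b : B, b ≠ 0 → 0 < LinearMap.trace ℚ B (LinearMap.mulLeft ℚ (b * star b))
  /-- the left `B`-module structure of `V` -/
  ρ : B →ₐ[ℚ] Module.End ℚ V
  /-- «finitely generated» -/
  finiteDimensionalV : FiniteDimensional ℚ V
  /-- «nonzero» -/
  nontrivialV : Nontrivial V
  /-- the `ℚ`-valued form `⟨·,·⟩` -/
  form : LinearMap.BilinForm ℚ V
  /-- alternating -/
  isAlt : ∀ v : V, form v v = 0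
  /-- nondegenerate -/
  nondegenerate : form.Nondegenerate
  /-- skew-Hermitian: `⟨b v, w⟩ = ⟨v, b* w⟩` -/
  skew : ∀ (b : B) (v w : V), form (ρ b v) w = form v (ρ (star b) w)
  /-- `h : ℂ → End_ℝ(V_ℝ)`, `V_ℝ = ℝ ⊗_ℚ V` -/
  h : ℂ →ₐ[ℝ] Module.End ℝ (ℝ ⊗[ℚ] V)
  /-- `h(z)` commutes with `B`: `h(z) ∈ C_ℝ` -/
  h_comm : ∀ (z : ℂ) (b : B), h z ∘ₗ (ρ b).baseChange ℝ = (ρ b).baseChange ℝ ∘ₗ h z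
  /-- `⟨h(z)v, w⟩ = ⟨v, h(z̄)w⟩` for the base-changed form -/
  h_adjoint : ∀ (z : ℂ) (v w : ℝ ⊗[ℚ] V), form.baseChange ℝ (h z v) w = form.baseChange ℝ v (h (conj z) w)
  /-- `⟨v, h(i)v⟩ > 0` for `v ≠ 0` -/
  h_pos : ∀ v : ℝ ⊗[ℚ] V, v ≠ 0 → 0 < form.baseChange ℝ v (h Complex.I v)

section Notation

variable {B : Type u} [Ring B] [Algebra ℚ B] [StarRing B] [StarModule ℚ B] {V : Type v} [AddCommGroup V] [Module ℚ V]

/-- `C = End_B(V)` (p. 389 L26): the commutant of `ρ(B)` in `End_ℚ(V)`. [cite: Kottwitz1992, §5 (p. 389)] -/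
def PELDatumQ.C (D : PELDatumQ B V) : Subalgebra ℚ (Module.End ℚ V) :=
  Subalgebra.centralizer ℚ (Set.range D.ρ)

end Notation

/-- `F₀`, the fixed field of `*` on the centre `F` of `B` (p. 389 L22), as the `ℚ`-submodule `F ⊓ Sym(B, *)` of `B`.
[cite: Kottwitz1992, §5 (p. 389)] -/
def F0 (B : Type u) [Ring B] [Algebra ℚ B] [StarRing B] [StarModule ℚ B] : Submodule ℚ B :=
  Subalgebra.toSubmodule (Subalgebra.center ℚ B) ⊓ selfAdjoint.submodule ℚ B

/-- **«`C = End_B(V)` is a simple `ℚ`-algebra with center `F`»** (p. 389, p0017 L26–L27): for the data of §5 the commutant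
`C` of `B` in `End_ℚ(V)` is simple, and its centre is the image of the centre `F` of `B`. [cite: Kottwitz1992, §5 (p. 389)] -/
def Kottwitz1992_5_C_simple : Prop :=
  ∀ (B : Type u) [Ring B] [Algebra ℚ B] [StarRing B] [StarModule ℚ B] (V : Type v) [AddCommGroup V] [Module ℚ V]
    (D : PELDatumQ B V), IsSimpleRing D.C ∧
      (Subalgebra.center ℚ D.C).map D.C.val = (Subalgebra.center ℚ B).map D.ρ

/-! ## (5.g) Cases A, C, D -/

/-- **Case A** (p. 391, p0019 L27–L29 and L35–L38): `*` is of the SECOND KIND, i.e. non-trivial on the centre `F` of `B`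
(«`F` is a totally complex quadratic extension of `F₀`»; then «`G₀` is an inner form of the quasi-split unitary group over `F₀`
obtained from the quadratic extension `F`»). [cite: Kottwitz1992, §5 (p. 391)] -/
def IsCaseA (B : Type u) [Ring B] [Algebra ℚ B] [StarRing B] : Prop :=
  ∃ x ∈ Subalgebra.center ℚ B, star x ≠ x

/-- **Case C** (p. 391, p0019 L38–L41: `*` of the first kind and «over an algebraic closure of `F₀`, the group `G₀` is […] a
symplectic group in `2n` variables»).  Typed by the algebraic proxy on `(B, *)` (module docstring): `*` trivial on the centre
`F` and of ORTHOGONAL type on `B` — `dim_ℚ B = d² [F : ℚ]` and `2 dim_ℚ Sym(B, *) = [F : ℚ] d (d + 1)` — which for the data of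
§5 (alternating skew-Hermitian form) is the condition that the adjoint involution of `C = End_B(V)` be of symplectic type,
`G₀ = Sp_{2n}` over `F̄₀`. [cite: Kottwitz1992, §5 (p. 391)] -/
def IsCaseC (B : Type u) [Ring B] [Algebra ℚ B] [StarRing B] [StarModule ℚ B] : Prop :=
  (∀ x ∈ Subalgebra.center ℚ B, star x = x) ∧ ∃ d : ℕ,
    Module.finrank ℚ B = d ^ 2 * Module.finrank ℚ (Subalgebra.center ℚ B) ∧
    2 * Module.finrank ℚ (selfAdjoint.submodule ℚ B) = Module.finrank ℚ (Subalgebra.center ℚ B) * (d * (d + 1))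

/-- **Case D** (p. 391, p0019 L38–L41: `*` of the first kind and «over an algebraic closure of `F₀`, the group `G₀` is […] an
orthogonal group in `2n` variables»).  Typed by the algebraic proxy on `(B, *)`: `*` trivial on the centre and of SYMPLECTIC
type on `B` — `dim_ℚ B = d² [F : ℚ]` and `2 dim_ℚ Sym(B, *) + [F : ℚ] d = [F : ℚ] d²` — i.e. the adjoint involution of
`C = End_B(V)` is of orthogonal type, `G₀ = O_{2n}` over `F̄₀`. [cite: Kottwitz1992, §5 (p. 391)] -/
def IsCaseD (B : Type u) [Ring B] [Algebra ℚ B] [StarRing B] [StarModule ℚ B] : Prop :=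
  (∀ x ∈ Subalgebra.center ℚ B, star x = x) ∧ ∃ d : ℕ,
    Module.finrank ℚ B = d ^ 2 * Module.finrank ℚ (Subalgebra.center ℚ B) ∧
    2 * Module.finrank ℚ (selfAdjoint.submodule ℚ B) + Module.finrank ℚ (Subalgebra.center ℚ B) * d =
      Module.finrank ℚ (Subalgebra.center ℚ B) * d ^ 2

/-- **The case trichotomy** (p. 391, p0019 L23–L41): for the data of §5 exactly one of Cases A, C, D holds («our moduli
problems fall into three families (Cases A, C, and D)» — second kind; first kind orthogonal `G₀`; first kind symplectic
`G₀`). [cite: Kottwitz1992, §5 (p. 391)] -/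
def Kottwitz1992_5_cases : Prop :=
  ∀ (B : Type u) [Ring B] [Algebra ℚ B] [StarRing B] [StarModule ℚ B] (V : Type v) [AddCommGroup V] [Module ℚ V],
    PELDatumQ B V →
      (IsCaseA B ∧ ¬ IsCaseC B ∧ ¬ IsCaseD B) ∨ (¬ IsCaseA B ∧ IsCaseC B ∧ ¬ IsCaseD B) ∨
        (¬ IsCaseA B ∧ ¬ IsCaseC B ∧ IsCaseD B)

/-! ## (5.e) The determinant criterion (p. 390) -/

/-- The polynomial `det_V = det(X₁α₁ + ⋯ + X_tα_t ; V ⊗_k k[X₁, …, X_t]) ∈ k[X₁, …, X_t]` of the finite-dimensional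
`E`-module `V` (`ρ : E → End_k(V)`) with respect to the `k`-basis `α` of `E` (p. 390, p0018 L25–L27), computed in the basis
`Module.finBasis k V` of `V`. [cite: Kottwitz1992, §5 (p. 390)] -/
noncomputable def detPoly {k : Type u} [Field k] {E : Type v} [Ring E] [Algebra k E] {t : ℕ} (α : Module.Basis (Fin t) k E)
    {V : Type w} [AddCommGroup V] [Module k V] [FiniteDimensional k V] (ρ : E →ₐ[k] Module.End k V) :
    MvPolynomial (Fin t) k :=
  Matrix.det (∑ i : Fin t, (MvPolynomial.X i : MvPolynomial (Fin t) k) •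
    ((LinearMap.toMatrix (Module.finBasis k V) (Module.finBasis k V) (ρ (α i))).map
      (MvPolynomial.C : k → MvPolynomial (Fin t) k)))

/-- **The determinant criterion** (p. 390, p0018 L22–L30): `E` a finite-dimensional semisimple algebra over a field `k` with
`k`-basis `α₁, …, α_t`; two finite-dimensional `E`-modules `V`, `W` are isomorphic if and only if `det_V = det_W` («This explains
why we use the determinant rather than the trace, since the analogous assertion regarding the trace is false when the
characteristic of `k` is finite»). [cite: Kottwitz1992, §5 (p. 390)] -/
def Kottwitz1992_5_det_iff : Prop :=
  ∀ (k : Type u) [Field k] (E : Type v) [Ring E] [Algebra k E] [FiniteDimensional k E] [IsSemisimpleRing E] (t : ℕ)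
    (α : Module.Basis (Fin t) k E) (V W : Type w) [AddCommGroup V] [Module k V] [FiniteDimensional k V] [AddCommGroup W]
    [Module k W] [FiniteDimensional k W] (ρV : E →ₐ[k] Module.End k V) (ρW : E →ₐ[k] Module.End k W),
    (∃ g : V ≃ₗ[k] W, ∀ (a : E) (v : V), g (ρV a v) = ρW a (g v)) ↔ detPoly α ρV = detPoly α ρW

/-! ## (5.g) `m` is even; (5.h) the shape of `C_ℝ` -/

/-- **«The existence of `h : ℂ → C_ℝ` forces `m` to be even»** (p. 391, p0019 L33–L34), `m = [F : F₀](dim_F C)^{1/2}`, typed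
for an involution of the FIRST kind (`F = F₀`, so `m² = dim_F C`; for the second kind `m` is even by definition): if `C` is a
finite-dimensional simple `ℚ`-algebra with involution `*` trivial on the centre `F` and positive there (`tr(x x*) > 0` for
central `x ≠ 0`, as it is for the centre of the `B` of §5 — so `F` is totally real), and `C_ℝ = ℝ ⊗_ℚ C` receives an
`ℝ`-algebra map from `ℂ`, then `dim_F C = (2n)²` for some `n`. [cite: Kottwitz1992, §5 (p. 391)] -/
def Kottwitz1992_5_m_even : Prop :=
  ∀ (C : Type u) [Ring C] [Algebra ℚ C] [StarRing C] [StarModule ℚ C] [FiniteDimensional ℚ C] [IsSimpleRing C],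
    (∀ x ∈ Subalgebra.center ℚ C, star x = x) →
    (∀ x ∈ Subalgebra.center ℚ C, x ≠ 0 → 0 < LinearMap.trace ℚ C (LinearMap.mulLeft ℚ (x * star x))) →
    Nonempty (ℂ →ₐ[ℝ] ℝ ⊗[ℚ] C) →
      ∃ n : ℕ, Module.finrank ℚ C = (2 * n) ^ 2 * Module.finrank ℚ (Subalgebra.center ℚ C)


/-- **(5.h), Case C** (p. 391, p0019 L41–L43): «in Case C the algebra `C_ℝ` is a product of `[F₀ : ℚ]` copies of `M_{2n}(ℝ)`»
(`m = 2n`, `m² [F : ℚ] = dim_ℚ C`; here `F₀ = F`). [cite: Kottwitz1992, §5 (p. 391)] -/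
def Kottwitz1992_5_CR_caseC : Prop :=
  ∀ (B : Type u) [Ring B] [Algebra ℚ B] [StarRing B] [StarModule ℚ B] (V : Type v) [AddCommGroup V] [Module ℚ V]
    (D : PELDatumQ B V), IsCaseC B → ∃ n : ℕ, 0 < n ∧
      Module.finrank ℚ D.C = (2 * n) ^ 2 * Module.finrank ℚ (Subalgebra.center ℚ B) ∧
      Nonempty ((ℝ ⊗[ℚ] D.C) ≃ₐ[ℝ] (Fin (Module.finrank ℚ (F0 B)) → Matrix (Fin (2 * n)) (Fin (2 * n)) ℝ))

/-- **(5.h), Case D** (p. 391, p0019 L43–L44): «in Case D it is a product of `[F₀ : ℚ]` copies of `M_n(ℍ)`» (`m = 2n`,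
`m² [F : ℚ] = dim_ℚ C`; `F₀ = F`). [cite: Kottwitz1992, §5 (p. 391)] -/
def Kottwitz1992_5_CR_caseD : Prop :=
  ∀ (B : Type u) [Ring B] [Algebra ℚ B] [StarRing B] [StarModule ℚ B] (V : Type v) [AddCommGroup V] [Module ℚ V]
    (D : PELDatumQ B V), IsCaseD B → ∃ n : ℕ, 0 < n ∧
      Module.finrank ℚ D.C = (2 * n) ^ 2 * Module.finrank ℚ (Subalgebra.center ℚ B) ∧
      Nonempty ((ℝ ⊗[ℚ] D.C) ≃ₐ[ℝ] (Fin (Module.finrank ℚ (F0 B)) → Matrix (Fin n) (Fin n) ℍ[ℝ]))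

/-- **(5.h), Case A** (p. 391, p0019 L44–L45): «in Case A it is a product of `[F₀ : ℚ]` copies of `M_n(ℂ)`» (`n² [F : ℚ] =
dim_ℚ C`, `m = [F : F₀] n = 2n`). [cite: Kottwitz1992, §5 (p. 391)] -/
def Kottwitz1992_5_CR_caseA : Prop :=
  ∀ (B : Type u) [Ring B] [Algebra ℚ B] [StarRing B] [StarModule ℚ B] (V : Type v) [AddCommGroup V] [Module ℚ V]
    (D : PELDatumQ B V), IsCaseA B → ∃ n : ℕ, 0 < n ∧
      Module.finrank ℚ D.C = n ^ 2 * Module.finrank ℚ (Subalgebra.center ℚ B) ∧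
      Nonempty ((ℝ ⊗[ℚ] D.C) ≃ₐ[ℝ] (Fin (Module.finrank ℚ (F0 B)) → Matrix (Fin n) (Fin n) ℂ))


/-! ## ED. 2 — (5.c)–(5.d) the moduli problem over the cell's letters; (5.f), (5.i), (5.j), (5.k) -/

section ModuliProblemED2

open _root_.CategoryTheory _root_.AlgebraicGeometry Polynomial
open Literature.AlgebraicGeometry.AbelianSchemes Literature.AlgebraicGeometry.Morphisms

/-- **The `p`-integral data of the moduli problem** (p. 389, p0017 L12–L33; p. 390, p0018 L1–L3) on top of the rational
datum `Q : PELDatumQ B V`: the prime `p`; the order of `B` through which `i` acts, given as a ring `O`, finitely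
generated over `ℤ`, with involution and an injective `*`-compatible ring map `toB : O → B` whose image spans `B` over `ℚ`
(print: «`𝒪_B` a `ℤ_(p)`-order in `B` […] `*` preserves `𝒪_B`», acting on `A` UP TO PRIME-TO-`p` ISOGENY; on honest
abelian schemes up to isomorphism — gap (g2) — the acting ring is a `ℤ`-order `O` with `O ⊗ ℤ_(p) = 𝒪_B`, as in the
cell's lines where `O = 𝒪_F`); `n = dim A = ½ dim_ℚ V` («`2 dim(A) = dim(V)`», p. 392 L17); a level `N` prime to `p` (standing in
for the compact open `K^p ⊆ G(𝔸_f^p)`: gap (g2) of the module docstring — `K^p = K(N)`); a polarization type `δ` prime to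
`p` («`λ` a prime-to-`p` isogeny», p. 390 L9); the base ring `R_E` «`𝒪_E ⊗_ℤ ℤ_(p)`» (p. 390 L5, posited as a parameter);
and the KOTTWITZ POLYNOMIALS `f_b ∈ R_E[T]`, `b ∈ 𝒪_B` — the single-element currency (gap (g3)) of the print's
`f(X₁, …, X_t) = det(X₁α₁ + ⋯ + X_tα_t; V₁)` «with coefficients in `𝒪_E ⊗_ℤ ℤ_(p)`», `f_b(T) = det(T − b; V₁)`, monic of
degree `n = dim_ℂ V₁`, TIED TO `Q.h` by `f_spec` (ED. 3): under an embedding `ι : R_E ↪ ℂ`, `f_b^ι` is the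
characteristic polynomial of `b` on `V₁ = {v ∈ V_ℂ | h(i)v = iv}` (`V_ℂ = ℂ ⊗_ℝ V_ℝ`, p. 389 L35–L38).  `O` is COMMUTATIVE
because ★ `AbelianSchemeOver.RingAction` is (gap (g1)).  THE STANDING HYPOTHESES of p. 389 consumed by (5.f), (5.i), (5.j),
(5.k) (ED. 3, QA-K1): «`B_{ℚ_p}` is a product of matrix algebras over UNRAMIFIED extensions of `ℚ_p`» and «the `p`-adic
completion of `𝒪_B` is a MAXIMAL order» — for the commutative order `O` both together say exactly that `O ⊗ ℤ_p` is a
finite étale `ℤ_p`-algebra, i.e. `O ∕ pO` is reduced (`good_p`); and «schemes `S` over `𝒪_E ⊗_ℤ ℤ_(p)`» — `R_E` is an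
integrally closed domain in which every integer prime to `p` is invertible and `p` is not (`loc`, `p_nonunit`, `isDomain`,
`isIntegrallyClosed`; with `f_spec` it contains the coefficients of the `f_b`, which generate the reflex field `E`, so it
contains `𝒪_E ⊗ ℤ_(p)` and the moduli scheme over `R_E` is the base change of Kottwitz's).  NOT recorded: «a self-dual
`𝒪_B`-stable lattice `Λ₀ ⊆ V_{ℚ_p}` exists» (needed for non-emptiness, consumed by no statement below).
[cite: Kottwitz1992, §5 (pp. 389–390)] -/
structure IntegralPELDatum (B : Type u) [Ring B] [Algebra ℚ B] [StarRing B] [StarModule ℚ B] (V : Type v)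
    [AddCommGroup V] [Module ℚ V] (O : Type w) [CommRing O] [StarRing O] (RE : Type u) [CommRing RE] where
  /-- the rational and real data `(B, *, V, ⟨·,·⟩, h)` -/
  Q : PELDatumQ B V
  /-- the prime `p` -/
  p : ℕ
  /-- `p` is prime -/
  p_prime : p.Prime
  /-- `O ↪ B` (`O ⊗ ℤ_(p) = 𝒪_B`) -/
  toB : O →+* B
  /-- `O → B` is injective -/
  toB_injective : Function.Injective toB
  /-- `*` preserves `O` -/
  toB_star : ∀ b : O, toB (star b) = star (toB b)
  /-- `O` is an order: finitely generated over `ℤ` … -/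
  fg : Module.Finite ℤ O
  /-- … and spanning `B` over `ℚ` -/
  span_toB : Submodule.span ℚ (Set.range toB) = ⊤
  /-- `n = dim A` -/
  n : ℕ
  /-- «`2 dim(A) = dim(V)`» -/
  two_n : 2 * n = Module.finrank ℚ V
  /-- the level (`K^p = K(N)`) -/
  N : ℕ
  /-- the level is prime to `p` -/
  N_prime_to_p : ¬ p ∣ N
  /-- the type of the polarization -/
  δ : Fin n → ℕ
  /-- the polarization is prime to `p` -/
  δ_prime_to_p : ∀ i, ¬ p ∣ δ i
  /-- the Kottwitz polynomials `f_b(T) = det(T − b; V₁) ∈ R_E[T]` -/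
  f : O → RE[X]
  /-- each `f_b` is monic -/
  f_monic : ∀ b, (f b).Monic
  /-- of degree `n = dim_ℂ V₁` -/
  f_natDegree : ∀ b, (f b).natDegree = n
  /-- (ED. 3) «𝒪_B ⊗ ℤ_p is a maximal order» and «B is unramified at p», for the commutative order `O`: `O ∕ pO` is reduced -/
  good_p : IsReduced (O ⧸ Ideal.span {(p : O)})
  /-- (ED. 3) `R_E` is a `ℤ_(p)`-algebra: every integer prime to `p` is invertible … -/
  loc : ∀ m : ℕ, ¬ p ∣ m → IsUnit (m : RE)
  /-- … and `p` is not -/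
  p_nonunit : ¬ IsUnit (p : RE)
  /-- (ED. 3) `R_E` is a domain … -/
  isDomain : IsDomain RE
  /-- … and integrally closed (so, with `f_spec`, `R_E ⊇ 𝒪_E ⊗ ℤ_(p)`) -/
  isIntegrallyClosed : IsIntegrallyClosed RE
  /-- (ED. 3) `f_b = det(T − b; V₁)`: under an embedding `ι : R_E ↪ ℂ`, `f_b^ι` is the characteristic polynomial of `b` acting
  (through `toB` and `ρ`) on the `i`-eigenspace `V₁` of `h(i)` in `V_ℂ = ℂ ⊗_ℝ (ℝ ⊗_ℚ V)` -/
  f_spec : haveI := Q.finiteDimensionalV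
    ∃ ι : RE →+* ℂ, Function.Injective ι ∧ ∀ b : O,
      ∃ hb : ∀ v ∈ Module.End.eigenspace ((Q.h Complex.I).baseChange ℂ) Complex.I,
          ((Q.ρ (toB b)).baseChange ℝ).baseChange ℂ v ∈ Module.End.eigenspace ((Q.h Complex.I).baseChange ℂ) Complex.I,
        (LinearMap.restrict (((Q.ρ (toB b)).baseChange ℝ).baseChange ℂ) hb).charpoly = (f b).map ι

variable {B : Type u} [Ring B] [Algebra ℚ B] [StarRing B] [StarModule ℚ B] {V : Type v} [AddCommGroup V] [Module ℚ V]
  {O : Type w} [CommRing O] [StarRing O] {RE : Type u} [CommRing RE]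

/-- **A quadruple `(A, λ, i, η̄)` over `S`** (p. 390, p0018 L6–L13) over the cell's letters: ★ `PolarizedAbelianSchemeWithLevel n N δ S`
(the abelian scheme `A → S` of relative dimension `n`, its dual pair, the polarization `λ` of type `δ`, Mumford's level-`N`
structure — «By forgetting the homomorphism `i` we get a morphism from our moduli problem to one considered by Mumford»,
p. 391 L15–L17) together with the action `i : 𝒪_B → End_S(A)` (★ `AbelianSchemeOver.RingAction`).  Gap (g2) of the module
docstring applies (honest abelian schemes, principal level `K(N)`). [cite: Kottwitz1992, §5 (p. 390)] -/
structure KottwitzTuple (I : IntegralPELDatum B V O RE) (S : Scheme.{u}) where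
  /-- `(A, Â, λ, η)` -/
  P : PolarizedAbelianSchemeWithLevel I.n I.N I.δ S
  /-- `i : 𝒪_B → End_S(A)` -/
  act : AbelianSchemeOver.RingAction O P.A

namespace KottwitzTuple

variable {I : IntegralPELDatum B V O RE} {S : Scheme.{u}}

/-- **«`i : 𝒪_B → End(A)` is a `*`-homomorphism for `*` on `𝒪_B` and the Rosati involution on `End(A)` obtained from the
polarization `λ`»** (p. 390, p0018 L10–L12), in the `λ⁻¹`-free form `i(b*) ∘ λ = λ ∘ i(b)^∨` with the dual homomorphism
★ `DualPair.dualIsogenyOver` (as ★ `EndomorphismStructureLocus` (E-R)). [cite: Kottwitz1992, §5 (p. 390)] -/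
def IsRosati (T : KottwitzTuple I S) : Prop :=
  ∀ b : O, haveI := T.act.isMonHom_i b
    T.act.i (star b) ≫ T.P.pol.lam = T.P.pol.lam ≫ AbelianSchemeOver.DualPair.dualIsogenyOver (T.act.i b) T.P.D T.P.D

/-- **The determinant condition** (p. 390, p0018 L14–L21: «the determinant of the `𝒪_S`-linear endomorphism
`X₁α₁ + ⋯ + X_tα_t` of `Lie(A)` […] be equal to the polynomial `f` […]; this equality `g = f` is what we mean by the
determinant condition»), for `S` over `Spec R_E` via `sS`, in the cell's currency (gap (g3)): at every LOCAL test point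
`g : Spec R → S` lying over `φ : R_E → R`, and for every `b ∈ 𝒪_B`, the chart-free characteristic polynomial of `ι(b)` on
`Lie(A_R ∕ R)` (★ `AbelianScheme.lieCharpoly` of the base-changed action ★ `RingAction.baseChange`) is `f_b` mapped to `R`.
(Equality of the coefficient sections of `𝒪_S` may be tested on all local rings mapping to `S`; `Lie` commutes with base
change, ★ `AbelianSchemeLieCharpolyBaseChangeComp`.) [cite: Kottwitz1992, §5 (p. 390)] -/
def IsDet (T : KottwitzTuple I S) (sS : S ⟶ Spec (CommRingCat.of RE)) : Prop :=
  ∀ (R : Type u) [CommRing R] [IsLocalRing R] (g : Spec (CommRingCat.of R) ⟶ S) (φ : RE →+* R),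
    g ≫ sS = Spec.map (CommRingCat.ofHom φ) → ∀ b : O,
      AbelianScheme.lieCharpoly (T.P.A.baseChange g).toAffine (T.P.relDim.baseChange g) ((T.act.baseChange g).i b)
        (@AbelianScheme.unit_left_comp_left R _ (T.P.A.baseChange g).toAffine ((T.act.baseChange g).i b)
          ((T.act.baseChange g).isMonHom_i b)) = (I.f b).map φ

/-- **(5.c) «`(A, λ, i, η̄)` is an `S`-valued point of the moduli problem»** (p. 390, p0018 L4–L21): the Rosati condition on `i`
and the determinant condition (the polarization type, relative dimension and level are carried by the letters).
[cite: Kottwitz1992, §5 (p. 390)] -/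
def IsPoint (T : KottwitzTuple I S) (sS : S ⟶ Spec (CommRingCat.of RE)) : Prop :=
  T.IsRosati ∧ T.IsDet sS

/-- **Isomorphism of quadruples** (p. 390, p0018 L31–L34: «a prime-to-`p` isogeny from `A` to `A′`, commuting with the action of
`𝒪_B`, carrying `η̄` into `η̄′`, and carrying `λ` into a scalar multiple of `λ′`»), over the letters (gap (g2)): an isomorphism of
Mumford triples — ★ `PolarizedAbelianSchemeWithLevel.IsBaseChangeVia` along `𝟙 S` via `(G, Ĝ)` — commuting with the actions,
`i₁(b) ∘ G = G ∘ i₂(b)`. [cite: Kottwitz1992, §5 (p. 390)] -/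
def Iso (T₁ T₂ : KottwitzTuple I S) : Prop :=
  ∃ (G : T₁.P.A.X.left ⟶ T₂.P.A.X.left) (Ĝ : T₁.P.D.hat.X.left ⟶ T₂.P.D.hat.X.left),
    T₁.P.IsBaseChangeVia T₂.P (𝟙 S) G Ĝ ∧ ∀ b : O, (T₁.act.i b).left ≫ G = G ≫ (T₂.act.i b).left

end KottwitzTuple

/-- **The scheme `S_{K^p}` over `𝒪_E ⊗_ℤ ℤ_(p)` representing the moduli problem** (p. 391, p0019 L13–L14), as a datum: a scheme
`M → Spec R_E` and, for every locally noetherian `R_E`-scheme `S` («the category of locally noetherian schemes `S` over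
`𝒪_E ⊗_ℤ ℤ_(p)`», p. 390 L5), a classifying `R_E`-morphism `S → M` for every `S`-point of the moduli problem, such that every
`R_E`-morphism `S → M` is classified, two points have the same classifying morphism iff they are isomorphic, and classifying
morphisms are compatible with pull-back (★ `IsBaseChangeVia` along `u : S′ → S` + the action clause) — i.e. `M` represents the
functor (5.c) of isomorphism classes of quadruples. [cite: Kottwitz1992, §5 (pp. 390–391)] -/
structure ModuliSchemeData (I : IntegralPELDatum B V O RE) where
  /-- the scheme `S_{K^p}` -/
  M : Scheme.{u}
  /-- its structure morphism to `Spec (𝒪_E ⊗ ℤ_(p))` -/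
  hom : M ⟶ Spec (CommRingCat.of RE)
  /-- the classifying morphism of an `S`-point of the moduli problem -/
  classify : ∀ {S : Scheme.{u}} [IsLocallyNoetherian S] (sS : S ⟶ Spec (CommRingCat.of RE)) (T : KottwitzTuple I S),
    T.IsPoint sS → {m : S ⟶ M // m ≫ hom = sS}
  /-- every `R_E`-morphism `S → M` classifies some point -/
  classify_surjective : ∀ {S : Scheme.{u}} [IsLocallyNoetherian S] (sS : S ⟶ Spec (CommRingCat.of RE)) (m : S ⟶ M),
    m ≫ hom = sS → ∃ (T : KottwitzTuple I S) (hT : T.IsPoint sS), (classify sS T hT).1 = m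
  /-- two points have the same classifying morphism iff they are isomorphic -/
  classify_eq_iff : ∀ {S : Scheme.{u}} [IsLocallyNoetherian S] (sS : S ⟶ Spec (CommRingCat.of RE))
    (T₁ T₂ : KottwitzTuple I S) (h₁ : T₁.IsPoint sS) (h₂ : T₂.IsPoint sS),
    (classify sS T₁ h₁).1 = (classify sS T₂ h₂).1 ↔ T₁.Iso T₂
  /-- classifying morphisms are compatible with pull-back along `u : S′ → S` -/
  classify_natural : ∀ {S S' : Scheme.{u}} [IsLocallyNoetherian S] [IsLocallyNoetherian S']
    (sS : S ⟶ Spec (CommRingCat.of RE)) (sS' : S' ⟶ Spec (CommRingCat.of RE)) (u : S' ⟶ S), u ≫ sS = sS' →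
    ∀ (T : KottwitzTuple I S) (T' : KottwitzTuple I S') (hT : T.IsPoint sS) (hT' : T'.IsPoint sS')
      (G : T'.P.A.X.left ⟶ T.P.A.X.left) (Ĝ : T'.P.D.hat.X.left ⟶ T.P.D.hat.X.left),
      T'.P.IsBaseChangeVia T.P u G Ĝ → (∀ b : O, (T'.act.i b).left ≫ G = G ≫ (T.act.i b).left) →
        (classify sS' T' hT').1 = u ≫ (classify sS T hT).1

/-- **(5.f) Representability** (p. 391, p0019 L13–L14): «For sufficiently small `K^p` this moduli problem is representable by
a quasiprojective scheme `S_{K^p}` over `𝒪_E ⊗_ℤ ℤ_(p)`» — for level `N ≥ 3` (prime to `p`) a `ModuliSchemeData` exists whose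
structure morphism is quasi-projective (★ `Morphisms.IsQuasiProjective`), under the standing hypotheses of the datum
(`good_p`, `loc`, …, ED. 3).  (The proof's key input, «`T ↦ End(A_T)` […]
representable by a disjoint union of projective schemes over `S`», p0019 L19–L22, is ★ `Morphisms.exists_homScheme_of_projective`;
relative representability of the ring action is ★ `AbelianSchemeOver.exists_ringAction_of_structureTable` ∕
`exists_opens_isClosed_structureTable_rosati_iff`.) [cite: Kottwitz1992, §5 (p. 391)] -/
def Kottwitz1992_5_representable : Prop :=
  ∀ (B : Type u) [Ring B] [Algebra ℚ B] [StarRing B] [StarModule ℚ B] (V : Type v) [AddCommGroup V] [Module ℚ V]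
    (O : Type w) [CommRing O] [StarRing O] (RE : Type u) [CommRing RE] (I : IntegralPELDatum B V O RE), 3 ≤ I.N →
    ∃ M : ModuliSchemeData I, IsQuasiProjective M.hom

/-- **(5.i) Smoothness** (p. 391 L46 – p. 392 L3): «Now assume that `p ≠ 2` if we are in Case D. Then for sufficiently small
`K^p` the scheme `S_{K^p}` is smooth over `𝒪_E ⊗_ℤ ℤ_(p)`» (Case D = `IsCaseD B` of ED. 1; Mathlib `Smooth`).  The standing
hypotheses `good_p` (unramified, maximal at `p`) and `loc`∕`p_nonunit`∕`isIntegrallyClosed` (base `𝒪_E ⊗ ℤ_(p)`) of the datum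
are LOAD-BEARING here (ED. 3, QA-K1): for `p` ramified in `𝒪_B` the naive moduli problem with this determinant condition is
not even flat (G. Pappas, J. Algebraic Geom. 9 (2000) 577–605; restated in Pappas–Rapoport–Smithling, *Local models of
Shimura varieties I*, arXiv 1011.5551, p. 17). [cite: Kottwitz1992, §5 (pp. 391–392)] -/
def Kottwitz1992_5_smooth : Prop :=
  ∀ (B : Type u) [Ring B] [Algebra ℚ B] [StarRing B] [StarModule ℚ B] (V : Type v) [AddCommGroup V] [Module ℚ V]
    (O : Type w) [CommRing O] [StarRing O] (RE : Type u) [CommRing RE] (I : IntegralPELDatum B V O RE)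
    (M : ModuliSchemeData I), 3 ≤ I.N → (IsCaseD B → I.p ≠ 2) → Smooth M.hom

/-- **(5.j) Finite type** (p. 392, p0020 L4–L9): «`S_{K^p}` is a finite disjoint union of projective schemes over Mumford's
space; in particular `S_{K^p}` is of finite type over `𝒪_E ⊗_ℤ ℤ_(p)`» (under the standing `p ≠ 2` in Case D, ibid. L4,
and the standing hypotheses of the datum, ED. 3; Mathlib `LocallyOfFiniteType` + `QuasiCompact`). [cite: Kottwitz1992, §5 (p. 392)] -/
def Kottwitz1992_5_finiteType : Prop :=
  ∀ (B : Type u) [Ring B] [Algebra ℚ B] [StarRing B] [StarModule ℚ B] (V : Type v) [AddCommGroup V] [Module ℚ V]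
    (O : Type w) [CommRing O] [StarRing O] (RE : Type u) [CommRing RE] (I : IntegralPELDatum B V O RE)
    (M : ModuliSchemeData I), 3 ≤ I.N → (IsCaseD B → I.p ≠ 2) → LocallyOfFiniteType M.hom ∧ QuasiCompact M.hom

/-- **(5.k) Properness when `C` is a division algebra** (p. 392, p0020 L9–L12): «Suppose that `C = End_B(V)` is a
division algebra. In this case we will show that `S_{K^p}` is projective over `𝒪_E ⊗_ℤ ℤ_(p)`, using the valuative criterion
of properness» (`C` = `PELDatumQ.C` of ED. 1; ★ `Morphisms.IsProjective`; standing `p ≠ 2` in Case D and the standing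
hypotheses of the datum, ED. 3). [cite: Kottwitz1992, §5 (p. 392)] -/
def Kottwitz1992_5_projective_of_division : Prop :=
  ∀ (B : Type u) [Ring B] [Algebra ℚ B] [StarRing B] [StarModule ℚ B] (V : Type v) [AddCommGroup V] [Module ℚ V]
    (O : Type w) [CommRing O] [StarRing O] (RE : Type u) [CommRing RE] (I : IntegralPELDatum B V O RE)
    (M : ModuliSchemeData I), 3 ≤ I.N → (IsCaseD B → I.p ≠ 2) → (∀ x : I.Q.C, x ≠ 0 → IsUnit x) →
    IsProjective M.hom

end ModuliProblemED2

end Literature.NumberTheory.Kottwitz1992.ModuliProblem
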